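import Literature.MathematicalPhysics.QuantumFieldTheory.IsingGaugeWilsonLoopCovarianceConfined
import Literature.Probability.LatticeModels.IsingLowTemperatureTruncatedDecay
import HarnessLib

/-!
# Confined-phase clustering of Wilson loops of `ℤ₂` lattice gauge theory on `ℤ³`, UNCONDITIONALLY in the
# strong-coupling window where the dual Ising model is in the Friedli–Velenik low-temperature regime

`IsingGaugeWilsonLoopCovarianceConfined.lean` proves, for `ℤ₂` lattice gauge theory on `ℤ³` at `β > 0`
(free infinite-volume state), exponential clustering of pairs of rectangular Wilson loops — and
Duncan–Schweinhart 2026 Prop. 24 for growing loops — from ONE hypothesis on the dual Ising model: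
exponential decay `⟨σ_a;σ_b⟩⁺_{β*} ≤ e^{-c‖a-b‖}` of the plus-state truncated two-point function at the
dual inverse temperature `β* = -½ log tanh β` (`znWilsonPairCov_clustering_of_truncated_decay`,
`znWilsonPairCov_growing_le_exp_of_truncated_decay`). For `0 < β < β_c` (confined phase,
`β* > β_c^{Ising}(ℤ³)`) that hypothesis is the named fact
`DuminilCopinGoswamiRaoufi2020_truncatedTwoPointPlus_expDecay 3` (Duminil-Copin–Goswami–Raoufi 2020
Thm 1.1).

`IsingLowTemperatureTruncatedDecay.lean` now PROVES that hypothesis in the low-temperature regime of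
the dual model (Friedli–Velenik 2017 Thm 5.16): `⟨σ_a;σ_b⟩⁺_{β'} ≤ e^{-(β'/2)‖a-b‖}` for
`β' ≥ ltBeta 3 = 1 + log 722`. This file records the consequence: in the strong-coupling window

  `tanh β ≤ e^{-2·ltBeta 3}`  (equivalently `β* ≥ ltBeta 3`; numerically `β ≤ artanh(e^{-2}/722²) ≈ 2.6·10⁻⁷`)

the confined-phase clustering of ALL pairs of rectangular Wilson loops, and the growing-loop upper bound,
hold UNCONDITIONALLY with rate `β*/2` (`znWilsonPairCov_clustering_of_dual_lowTemperature`,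
`znWilsonPairCov_growing_le_exp_of_dual_lowTemperature`). The complementary part `(β₁, β_c)` of the
confined phase remains conditional on [DCGR20]. This window sits inside the strong-coupling regime where
the tree also has the Osterwalder–Seiler cluster-expansion clustering
(`znWilsonPairCov_strongCoupling_clustering`, `ZnWilsonLoopStrongCouplingClustering.lean`); the present
route is the dual one (low-temperature contours of the `ℤ³` Ising model), as in Duncan–Schweinhart's
proof of Prop. 24 «by [DCGR20]» and Forsström–Viklund's Prop. 6.8 «β sufficiently small».

HONEST FRAMING (cell ym-ir): an abelian `ℤ₂`, `d = 3`, strong-coupling statement; width 0 toward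
`SU(N)` ∕ the infrared leaf; the Yang–Mills mass gap (Clay) is NOT proved by any of this; R4 closes only
the conditional finite-`𝕋⁴` rung `BalabanLadder.UV`.

## References

* S. Friedli, Y. Velenik, *Statistical Mechanics of Lattice Systems*, CUP 2017, Thm. 5.16. [FriedliVelenik2017]
* M. P. Forsström, F. Viklund, arXiv:2502.19942, Prop. 6.8 («β sufficiently small»). [ForsstromViklund2025currents]
* P. Duncan, B. Schweinhart, arXiv:2607.02434, Prop. 24 and Thm 8. [DuncanSchweinhart2026]
* H. Duminil-Copin, S. Goswami, A. Raoufi, CMP 374 (2020), Thm 1.1. [DuminilCopinGoswamiRaoufi2020]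
-/

noncomputable section

open Filter Topology
open scoped symmDiff
open Literature.Probability.LatticeModels
open Literature.Probability.LatticeModels.LTContour (ltBeta plusCorr_truncated_le_exp one_le_ltBeta)

namespace Literature.MathematicalPhysics.QuantumFieldTheory

namespace Z2Duality

/-- The window in gauge terms: `β* ≥ B` iff `tanh β ≤ e^{-2B}` (`β > 0`). [cite: Aizenman2025, §9.2 (e^{-2β*} = tanh β)] -/
theorem le_dualBeta_iff_tanh_le {β : ℝ} (hβ : 0 < β) (B : ℝ) :
    B ≤ dualBeta β ↔ Real.tanh β ≤ Real.exp (-2 * B) := by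
  rw [← exp_neg_two_mul_dualBeta hβ, Real.exp_le_exp]
  constructor <;> intro h <;> linarith

/-- **The dual low-temperature input as a theorem** (F–V Thm 5.16 at `β*`): if `β* ≥ ltBeta 3` then
`⟨σ_a;σ_b⟩⁺_{β*} ≤ e^{-(β*/2)‖a-b‖}` for all `a, b ∈ ℤ³`. [cite: FriedliVelenik2017, Thm. 5.16] -/
theorem plusCorr_truncatedTwoPoint_dualBeta_expDecay_of_lowTemperature {β : ℝ}
    (h : ltBeta 3 ≤ dualBeta β) :
    ∀ a b : Probability.LatticeModels.Site 3,
      plusCorr 3 (dualBeta β) 0 (({a} : Finset (Probability.LatticeModels.Site 3)) ∆ {b}) -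
        plusCorr 3 (dualBeta β) 0 {a} * plusCorr 3 (dualBeta β) 0 {b} ≤
          Real.exp (-(dualBeta β / 2 * ‖a - b‖)) :=
  fun a b => (plusCorr_truncated_le_exp (d := 3) (by norm_num) h a b).2

/-- **Confined-phase clustering of Wilson loops, unconditional in the dual low-temperature window.**
For `β > 0` with `tanh β ≤ e^{-2·ltBeta 3}` and all rectangular loops `γ = ∂(rectPlaqs x i j R T)`,
`γ' = ∂(rectPlaqs x' i' j' R' T')` (`i < j`, `i' < j'`): `∃ C, ∀ a ∈ ℤ³,
0 ≤ ⟨W_γ ; W_{γ'+a}⟩_β ≤ C e^{-(β*/2)‖a‖_∞}`. [cite: ForsstromViklund2025currents, Prop. 6.8 (β sufficiently small, d = 3); DuncanSchweinhart2026 Prop. 24; FriedliVelenik2017 Thm. 5.16] -/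
theorem znWilsonPairCov_clustering_of_dual_lowTemperature {β : ℝ} (hβ : 0 < β)
    (hw : Real.tanh β ≤ Real.exp (-2 * ltBeta 3))
    (x x' : Probability.LatticeModels.Site 3) {i j i' j' : Fin 3} (hij : i < j) (hij' : i' < j')
    (R T R' T' : ℕ) :
    ∃ C : ℝ, ∀ a : Probability.LatticeModels.Site 3,
      0 ≤ znWilsonPairCov 2 β x i j R T (x' + a) i' j' R' T' ∧
        znWilsonPairCov 2 β x i j R T (x' + a) i' j' R' T' ≤ C * Real.exp (-(dualBeta β / 2 * ‖a‖)) := by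
  have h := (le_dualBeta_iff_tanh_le hβ (ltBeta 3)).2 hw
  have hpos : 0 < dualBeta β / 2 := by have := one_le_ltBeta 3; linarith
  exact znWilsonPairCov_clustering_of_truncated_decay hβ hpos
    (plusCorr_truncatedTwoPoint_dualBeta_expDecay_of_lowTemperature h) x x' hij hij' R T R' T'

/-- **Duncan–Schweinhart 2026 Prop. 24 for growing loops, unconditional in the dual low-temperature
window**: for `β > 0` with `tanh β ≤ e^{-2·ltBeta 3}`, `i < j`, and `f : ℕ → ℕ` with `f(N)²/N → 0`,
eventually in `N`, for all `x`, `0 ≤ Cov_β(W_{γ(N)}, W_{γ(N)+Ne_k}) ≤ e^{-(β*/4)N}`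
(`γ(N) = ∂(rectPlaqs x i j f(N) f(N))`, `k = third i j`). [cite: DuncanSchweinhart2026, Prop. 24 (pp. 19–20); FriedliVelenik2017 Thm. 5.16] -/
theorem znWilsonPairCov_growing_le_exp_of_dual_lowTemperature {β : ℝ} (hβ : 0 < β)
    (hw : Real.tanh β ≤ Real.exp (-2 * ltBeta 3)) {i j : Fin 3} (hij : i < j) {f : ℕ → ℕ}
    (hf : Tendsto (fun N : ℕ => ((f N : ℝ) ^ 2) / N) atTop (𝓝 0)) :
    ∀ᶠ N : ℕ in atTop, ∀ x : Probability.LatticeModels.Site 3,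
      0 ≤ znWilsonPairCov 2 β x i j (f N) (f N) (x + Pi.single (third i j) (N : ℤ)) i j (f N) (f N) ∧
        znWilsonPairCov 2 β x i j (f N) (f N) (x + Pi.single (third i j) (N : ℤ)) i j (f N) (f N) ≤
          Real.exp (-(dualBeta β / 2 / 2 * N)) := by
  have h := (le_dualBeta_iff_tanh_le hβ (ltBeta 3)).2 hw
  have hpos : 0 < dualBeta β / 2 := by have := one_le_ltBeta 3; linarith
  exact znWilsonPairCov_growing_le_exp_of_truncated_decay hβ hpos
    (plusCorr_truncatedTwoPoint_dualBeta_expDecay_of_lowTemperature h) hij hf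

end Z2Duality

end Literature.MathematicalPhysics.QuantumFieldTheory
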